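import Summits.Ventures.PercRepro.RankLevelSetHallBooleanWeights

/-!
# PercRepro — THE BOOLEAN DEFICIT INEQUALITY: UP-HALL AT THE TIGHT LAYER REDUCED TO THE DEMAND OF THE MEMBERS
(p4, gen 40; paper proofs/P4-DEMAND.md §1–§2; C-044 at the tight layer `#E = p + q`, any `k = p − q ≥ 2`)

With the Boolean UP weights of RankLevelSetHallBooleanWeights (receipt exactly `Φ(p, q)`, demand `δ(Z)` spent on the lost supersets),
every set `S` is loaded at most `#{members inside S}/C(#S, q) ≤ 1` (`sum_boolWeight_le_one`), and a middle-size superset of a member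
is a small UP-neighbour (rank `> q`) or a lost set (rank `q`).  Hence **THE BOOLEAN DEFICIT INEQUALITY** (`phi_mul_ncard_add_big_le`):
for every family `𝒜` of members,
    `Φ(p,q)·#𝒜 + #Big(𝒜) ≤ #N_up(𝒜) + Σ_{Z ∈ 𝒜} δ(Z)`,
and **THE DEMAND TRANSFER** (`hallUp_of_demand_le_big`): the UP-Hall condition holds for `𝒜` as soon as `Σ_{Z ∈ 𝒜} δ(Z) ≤ #Big(𝒜)` —
a strictly weaker hypothesis than `#Lost(𝒜) ≤ #Big(𝒜)` (`hallUp_of_lost_le_big`), since `Σ_Z δ(Z) = Σ_{T ∈ Lost(𝒜)} m_𝒜(T)/C(#T, q)`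
with `m_𝒜(T) ≤ C(#T, q)` the members of `𝒜` inside `T`.  Census (p4 g40, exact max-flow): the Hall ratio of the transport problem
«member `Z` supplies `δ(Z)` to its big supersets of size `p`, capacities `1`» is `≥ 2` on every instance tested (random GF(2,3,5)
`n ≤ 11`, the fat, killer, parallel-pair and book-sum families, `B₄ ⊕ B₅` at `n = 20`: `5.14`), against `1.0 – 1.33` for the unweighted
lost → big graph.  Nothing beyond the inequality and the transfer is asserted.

* `card_filter_members_subset_le_choose`, `sum_boolWeight_le_one`, `mem_smallUpSets_of_mid`, `mem_lostUpSets_of_mid`;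
* **`phi_mul_ncard_add_big_le`**, **`hallUp_of_demand_le_big`**.
Axioms: standard.
-/

namespace PercRepro

open Set Matroid Finset

variable {α : Type} (M : Matroid α) [M.Finite]

open Classical in
/-- **At most `C(#S, q)` members of a family lie inside a set `S`** (they are distinct `q`-subsets of `S`). -/
theorem card_filter_members_subset_le_choose (p q : ℕ) (hE : M.E.ncard = p + q) (𝒜f : Finset (Set α))
    (h𝒜 : ∀ Z ∈ 𝒜f, Z ∈ cellMembers M p q) {S : Set α} (hS : S.Finite) :
    (𝒜f.filter (fun Z => Z ⊆ S)).card ≤ S.ncard.choose q := by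
  classical
  let φ : Set α → Finset α := fun Z => if h : Z.Finite then h.toFinset else ∅
  have hmaps : ∀ Z ∈ 𝒜f.filter (fun Z => Z ⊆ S), φ Z ∈ hS.toFinset.powersetCard q := by
    intro Z hZ
    rw [Finset.mem_filter] at hZ
    obtain ⟨hZ𝒜, hZS⟩ := hZ
    have hZfin : Z.Finite := hS.subset hZS
    rw [Finset.mem_powersetCard]
    simp only [φ, dif_pos hZfin]
    constructor
    · intro x hx
      rw [Set.Finite.mem_toFinset] at hx ⊢
      exact hZS hx
    · rw [← ncard_eq_toFinset_card _ hZfin]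
      exact ncard_eq_q_of_mem_cellMembers_tight M hE (h𝒜 Z hZ𝒜)
  have hinj : Set.InjOn φ ((𝒜f.filter (fun Z => Z ⊆ S)) : Set (Set α)) := by
    intro Z hZ Z' hZ' heq
    rw [Finset.mem_coe, Finset.mem_filter] at hZ hZ'
    have hZfin : Z.Finite := hS.subset hZ.2
    have hZ'fin : Z'.Finite := hS.subset hZ'.2
    simp only [φ, dif_pos hZfin, dif_pos hZ'fin] at heq
    rw [← hZfin.coe_toFinset, ← hZ'fin.coe_toFinset, heq]
  calc (𝒜f.filter (fun Z => Z ⊆ S)).card = ((𝒜f.filter (fun Z => Z ⊆ S)).image φ).card :=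
        (Finset.card_image_of_injOn hinj).symm
    _ ≤ (hS.toFinset.powersetCard q).card := by
        apply Finset.card_le_card
        intro T hT
        rw [Finset.mem_image] at hT
        obtain ⟨Z, hZ, rfl⟩ := hT
        exact hmaps Z hZ
    _ = S.ncard.choose q := by rw [Finset.card_powersetCard, ← ncard_eq_toFinset_card _ hS]

/-- **Every set is loaded at most `1`** by the Boolean UP weights of any family of members. -/
theorem sum_boolWeight_le_one (p q : ℕ) (hE : M.E.ncard = p + q) (𝒜f : Finset (Set α))
    (h𝒜 : ∀ Z ∈ 𝒜f, Z ∈ cellMembers M p q) {S : Set α} (hS : S.Finite) :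
    ∑ Z ∈ 𝒜f, boolWeight q Z S ≤ 1 := by
  classical
  have h1 : ∑ Z ∈ 𝒜f, boolWeight q Z S = ∑ Z ∈ 𝒜f.filter (fun Z => Z ⊆ S), 1 / ((S.ncard.choose q : ℕ) : ℚ) := by
    rw [Finset.sum_filter]
    apply Finset.sum_congr rfl
    intro Z _
    unfold boolWeight
    rfl
  rw [h1, Finset.sum_const, nsmul_eq_mul]
  by_cases hc : S.ncard.choose q = 0
  · rw [hc]
    simp
  · have hpos : (0 : ℚ) < ((S.ncard.choose q : ℕ) : ℚ) := by
      exact_mod_cast Nat.pos_of_ne_zero hc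
    rw [mul_one_div, div_le_one hpos]
    exact_mod_cast card_filter_members_subset_le_choose M p q hE 𝒜f h𝒜 hS

/-- A middle-size superset of a member of `𝒜` with rank `> q` is a small UP-neighbour of `𝒜`. -/
theorem mem_smallUpSets_of_mid (p q : ℕ) {𝒜 : Set (Set α)} {S Z : Set α} (hS : S ∈ midSets M p q) (hZ𝒜 : Z ∈ 𝒜)
    (hZS : Z ⊆ S) (hrk : (q : ℕ∞) < M.eRk S) : S ∈ smallUpSets M p q 𝒜 := by
  obtain ⟨hSE, -, hp'⟩ := hS
  have hSfin : S.Finite := (M.set_finite M.E).subset hSE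
  refine ⟨⟨hSE, hrk, ?_, Z, hZ𝒜, hZS⟩, hp'⟩
  calc M.eRk S ≤ S.encard := M.eRk_le_encard S
    _ = (S.ncard : ℕ∞) := hSfin.cast_ncard_eq.symm
    _ < (p : ℕ∞) := by exact_mod_cast hp'

omit [M.Finite] in
/-- A middle-size superset of a member of `𝒜` with rank `≤ q` is a lost set of `𝒜`. -/
theorem mem_lostUpSets_of_mid (p q : ℕ) {𝒜 : Set (Set α)} {S Z : Set α} (hS : S ∈ midSets M p q) (hZ : Z ∈ cellMembers M p q)
    (hZ𝒜 : Z ∈ 𝒜) (hZS : Z ⊆ S) (hrk : ¬ (q : ℕ∞) < M.eRk S) : S ∈ lostUpSets M p q 𝒜 := by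
  obtain ⟨hSE, hq, hp'⟩ := hS
  refine ⟨hSE, hq, hp', le_antisymm (not_lt.1 hrk) ?_, Z, hZ𝒜, hZS⟩
  rw [← hZ.2.1]
  exact M.eRk_mono hZS

/-- **THE BOOLEAN DEFICIT INEQUALITY** (tight layer, any `k ≥ 2`): for every family `𝒜` of members,
`Φ(p, q)·#𝒜 + #Big(𝒜) ≤ #N_up(𝒜) + Σ_{Z ∈ 𝒜} δ(Z)` — the Boolean UP weights deliver `Φ` to every member and load every set at
most `1`; the only weight not landing on an UP-neighbour is the demand `δ(Z)` spent on the lost supersets. -/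
theorem phi_mul_ncard_add_big_le (p q : ℕ) (hp : q + 2 ≤ p) (hE : M.E.ncard = p + q) {𝒜 : Set (Set α)}
    (h𝒜 : 𝒜 ⊆ cellMembers M p q) :
    phiK p q * (𝒜.ncard : ℚ) + ((bigUpSets M p q 𝒜).ncard : ℚ)
      ≤ ((upNbhd M p q 𝒜).ncard : ℚ) + ∑ Z ∈ ((cellMembers_finite M p q).subset h𝒜).toFinset, lostDemand M p q Z := by
  classical
  have h𝒜fin : 𝒜.Finite := (cellMembers_finite M p q).subset h𝒜
  set 𝒜f : Finset (Set α) := h𝒜fin.toFinset with h𝒜f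
  have hmem𝒜 : ∀ Z, Z ∈ 𝒜f ↔ Z ∈ 𝒜 := fun Z => by rw [h𝒜f, Set.Finite.mem_toFinset]
  have h𝒜M : ∀ Z ∈ 𝒜f, Z ∈ cellMembers M p q := fun Z hZ => h𝒜 ((hmem𝒜 Z).1 hZ)
  have h𝒜card : (𝒜.ncard : ℚ) = (𝒜f.card : ℚ) := by rw [h𝒜f, ncard_eq_toFinset_card _ h𝒜fin]
  set Pf : Finset (Set α) := (midSets_finite M p q).toFinset with hPf
  have hmemPf : ∀ S, S ∈ Pf ↔ S ∈ midSets M p q := fun S => by rw [hPf, Set.Finite.mem_toFinset]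
  set Lf : Finset (Set α) := (lostUpSets_finite M p q 𝒜).toFinset with hLf
  have hmemLf : ∀ S, S ∈ Lf ↔ S ∈ lostUpSets M p q 𝒜 := fun S => by rw [hLf, Set.Finite.mem_toFinset]
  have hEfin : M.E.Finite := M.set_finite M.E
  -- step 1: Φ·#𝒜 = Σ_Z Σ_S w
  have h1 : phiK p q * (𝒜f.card : ℚ) = ∑ Z ∈ 𝒜f, ∑ S ∈ Pf, boolWeight q Z S := by
    rw [mul_comm, ← nsmul_eq_mul, ← Finset.sum_const]
    apply Finset.sum_congr rfl
    intro Z hZ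
    exact (sum_boolWeight_eq_phiK M p q hp hE (h𝒜M Z hZ)).symm
  -- step 2: per set, the load is at most [small] + [lost]·load
  have h2 : ∀ S ∈ Pf, ∑ Z ∈ 𝒜f, boolWeight q Z S
      ≤ (if S ∈ smallUpSets M p q 𝒜 then (1 : ℚ) else 0)
        + (if S ∈ lostUpSets M p q 𝒜 then ∑ Z ∈ 𝒜f, boolWeight q Z S else 0) := by
    intro S hS
    have hSmid : S ∈ midSets M p q := (hmemPf S).1 hS
    have hSfin : S.Finite := hEfin.subset hSmid.1
    have hload := sum_boolWeight_le_one M p q hE 𝒜f h𝒜M hSfin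
    have hnn : 0 ≤ ∑ Z ∈ 𝒜f, boolWeight q Z S := Finset.sum_nonneg (fun Z _ => boolWeight_nonneg q Z S)
    by_cases hex : ∃ Z ∈ 𝒜, Z ⊆ S
    · obtain ⟨Z, hZ𝒜, hZS⟩ := hex
      by_cases hrk : (q : ℕ∞) < M.eRk S
      · rw [if_pos (mem_smallUpSets_of_mid M p q hSmid hZ𝒜 hZS hrk)]
        have h0 : (0 : ℚ) ≤ (if S ∈ lostUpSets M p q 𝒜 then ∑ Z ∈ 𝒜f, boolWeight q Z S else 0) := by
          split_ifs
          · exact hnn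
          · exact le_rfl
        linarith
      · rw [if_pos (mem_lostUpSets_of_mid M p q hSmid (h𝒜 hZ𝒜) hZ𝒜 hZS hrk)]
        have h0 : (0 : ℚ) ≤ (if S ∈ smallUpSets M p q 𝒜 then (1 : ℚ) else 0) := by
          split_ifs
          · exact zero_le_one
          · exact le_rfl
        linarith
    · have hzero : ∑ Z ∈ 𝒜f, boolWeight q Z S = 0 := by
        apply Finset.sum_eq_zero
        intro Z hZ
        unfold boolWeight
        rw [if_neg]
        intro hZS
        exact hex ⟨Z, (hmem𝒜 Z).1 hZ, hZS⟩
      rw [hzero]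
      split_ifs <;> norm_num
  -- step 3: the small indicators sum to #small (small ⊆ mid)
  have h3 : ∑ S ∈ Pf, (if S ∈ smallUpSets M p q 𝒜 then (1 : ℚ) else 0) = ((smallUpSets M p q 𝒜).ncard : ℚ) := by
    rw [Finset.sum_ite, Finset.sum_const_zero, add_zero, Finset.sum_const, nsmul_eq_mul, mul_one]
    have hU : smallUpSets M p q 𝒜 = ((Pf.filter (fun S => S ∈ smallUpSets M p q 𝒜) : Finset (Set α)) : Set (Set α)) := by
      ext S
      rw [Finset.coe_filter, Set.mem_setOf_eq, hmemPf]
      constructor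
      · intro hS
        refine ⟨⟨hS.1.1, q_lt_ncard_of_mem_upNbhd M p q hS.1, hS.2⟩, hS⟩
      · intro hS
        exact hS.2
    have hc : (smallUpSets M p q 𝒜).ncard = (Pf.filter (fun S => S ∈ smallUpSets M p q 𝒜)).card := by
      rw [← ncard_coe_finset]
      exact congrArg Set.ncard hU
    rw [hc]
  -- step 4: the lost part is the total demand (lost ⊆ mid)
  have h4 : ∑ S ∈ Pf, (if S ∈ lostUpSets M p q 𝒜 then ∑ Z ∈ 𝒜f, boolWeight q Z S else 0)
      = ∑ Z ∈ 𝒜f, lostDemand M p q Z := by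
    rw [← Finset.sum_filter]
    have hLP : Pf.filter (fun S => S ∈ lostUpSets M p q 𝒜) = Lf := by
      ext S
      rw [Finset.mem_filter, hmemPf, hmemLf]
      constructor
      · intro h
        exact h.2
      · intro h
        exact ⟨⟨h.1, h.2.1, h.2.2.1⟩, h⟩
    rw [hLP, Finset.sum_comm]
    apply Finset.sum_congr rfl
    intro Z hZ
    exact sum_boolWeight_lost_eq_lostDemand M p q hE (h𝒜M Z hZ) ((hmem𝒜 Z).1 hZ)
  -- assemble
  have hup : ((upNbhd M p q 𝒜).ncard : ℚ) = ((smallUpSets M p q 𝒜).ncard : ℚ) + ((bigUpSets M p q 𝒜).ncard : ℚ) := by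
    rw [ncard_upNbhd_eq]
    push_cast
    ring
  have hmain : phiK p q * (𝒜f.card : ℚ) ≤ ((smallUpSets M p q 𝒜).ncard : ℚ) + ∑ Z ∈ 𝒜f, lostDemand M p q Z := by
    calc phiK p q * (𝒜f.card : ℚ) = ∑ Z ∈ 𝒜f, ∑ S ∈ Pf, boolWeight q Z S := h1
      _ = ∑ S ∈ Pf, ∑ Z ∈ 𝒜f, boolWeight q Z S := Finset.sum_comm
      _ ≤ ∑ S ∈ Pf, ((if S ∈ smallUpSets M p q 𝒜 then (1 : ℚ) else 0)
            + (if S ∈ lostUpSets M p q 𝒜 then ∑ Z ∈ 𝒜f, boolWeight q Z S else 0)) := Finset.sum_le_sum h2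
      _ = ((smallUpSets M p q 𝒜).ncard : ℚ) + ∑ Z ∈ 𝒜f, lostDemand M p q Z := by rw [Finset.sum_add_distrib, h3, h4]
  rw [h𝒜card, hup]
  linarith

/-- **THE DEMAND TRANSFER**: the UP-Hall condition holds for a family `𝒜` of members as soon as the total demand of `𝒜` is at
most its number of big UP-neighbours, `Σ_{Z ∈ 𝒜} δ(Z) ≤ #Big(𝒜)` — weaker than `#Lost(𝒜) ≤ #Big(𝒜)` (`hallUp_of_lost_le_big`). -/
theorem hallUp_of_demand_le_big (p q : ℕ) (hp : q + 2 ≤ p) (hE : M.E.ncard = p + q) {𝒜 : Set (Set α)}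
    (h𝒜 : 𝒜 ⊆ cellMembers M p q)
    (h : ∑ Z ∈ ((cellMembers_finite M p q).subset h𝒜).toFinset, lostDemand M p q Z ≤ ((bigUpSets M p q 𝒜).ncard : ℚ)) :
    phiK p q * (𝒜.ncard : ℚ) ≤ ((upNbhd M p q 𝒜).ncard : ℚ) := by
  have := phi_mul_ncard_add_big_le M p q hp hE h𝒜
  linarith

end PercRepro
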